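import Literature.MathematicalPhysics.QuantumLattice.HubbardBandBottomModes
import HarnessLib

/-!
# Ventures/CertifiedManyBodySolver — Observables/GHFClassFloorGram.lean
# Gram (one-particle density matrix) bookkeeping for the generalised-Hartree–Fock class floor (part 1 of 2;
# part 2: `GHFClassFloor.lean`)

HONEST FRAMING: first certified bounds; not a superconductivity verdict; every number certified or labelled float.
A competing-order EXCLUSION removes a named class of candidate ground states; it never says which order is present;
no phase sentence follows.

Cell `hubbard-tc` (MO-S3, D-0096), seat `hubbard-tc-mod-3` (G3: competing orders — stripe/CDW/AF — as EXCLUSION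
inputs from certified energy ORDERINGS), `prover-hubbard-tc-mod-3-g9-0`. Family `hubbard`; namespace
`Summit.Ventures.CertifiedManyBodySolver.Observables.GHFClassFloor`.

Two hypothesis-free facts about the Gram matrix `g_{ij} = ⟨c_i φ, c_j φ⟩ = ⟨φ, c†_i c_j φ⟩` of an ARBITRARY Fock
vector on the Jordan–Wigner Fock space `Fock ι = Finset ι → ℂ`:

* §1 `sum_norm_sq_gram_le` — **`γ² ≤ γ` row by row**: `Σ_j |g_{ij}|² ≤ ‖φ‖² g_{ii}` (the smeared-mode Pauli
  bound `‖c(f)ψ‖² ≤ ‖f‖²‖ψ‖²`, `normSq_annihilate_mulVec_le_mul`, with `f_j = g_{ij}`, and Cauchy–Schwarz);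
* §2 `four_localMoment_add_frob_le` — on Hubbard orbitals `Λ × {↑,↓}`:
  `Σ_x [(Re⟨n_{x↑}-n_{x↓}⟩)² + 4|⟨c†_{x↑}c_{x↓}⟩|²] + Σ_{x,y}|Σ_σ ⟨c†_{xσ}c_{yσ}⟩|² ≤ 2‖φ‖² Re⟨N̂⟩`, i.e. for
  `‖φ‖ = 1`: **four times the summed squared local moments plus the Frobenius mass of the spin-traced
  one-particle density matrix is at most `2N`** (a parallelogram identity per pair of sites; the off-diagonal
  spin entries are dropped).

These feed the energy floor of the complete gHF (quasi-free) class in `GHFClassFloor.lean`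
(`e ≥ -(1/(U|Λ|))Σ|t_{xy}|² - (U/2)n(1-n)`, `= -4t²/U` at half filling). Everything is PROVED (0 sorry, no
definition, standard axioms). WHAT THIS IS NOT: a phase word; a statement about any order parameter.

Tree / Mathlib search — REUSED: `RayleighBound.annihilate`, `create`, `normSq`, `annihilate_mul_create_add`,
`star_dotProduct_self_eq_normSq` (`HubbardWave0RayleighProofs`); `HubbardBandBottom.star_dotProduct_numberMode_mulVec`,
`star_dotProduct_annihilate_create_mulVec`, `normSq_annihilate_mulVec_le` (unit-mode version; `HubbardBandBottomModes`);
`numberOp`, `totalNumber`, `orb` (`HubbardWave0`). Mathlib: `norm_inner_le_norm`, `EuclideanSpace.inner_toLp_toLp`,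
`EuclideanSpace.norm_sq_eq`, `norm_star`, `Matrix.star_dotProduct`, `Matrix.star_mulVec`.
`lean search 'gram.*le|normSq_annihilate_mulVec_le'`: only the unit-mode Pauli bound exists.

References: V. Bach, E. H. Lieb, J. P. Solovej, J. Stat. Phys. 76 (1994) 3–89, §2 (1-pdm `0 ≤ γ ≤ 1`, eq. (2a.7);
quasi-free states, eq. (2c.36)) [BachLiebSolovej1994]; O. Bratteli, D. W. Robinson, *Operator Algebras and Quantum
Statistical Mechanics II* (1997) §5.2.2, Prop. 5.2.2 (`‖a(f)‖ = ‖f‖`) [BratteliRobinsonII1997].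
-/

noncomputable section

namespace Summit.Ventures.CertifiedManyBodySolver.Observables

namespace GHFClassFloor

open Literature.MathematicalPhysics.QuantumLattice
open Matrix Finset
  Literature.MathematicalPhysics.QuantumLattice.RayleighBound
  Literature.MathematicalPhysics.QuantumLattice.HubbardBandBottom
open scoped ComplexOrder ComplexConjugate

/-! ### §1 Gram bookkeeping on the Jordan–Wigner Fock space -/

section Gram

variable {ι : Type*} [LinearOrder ι] [Fintype ι]

/-- `⟨φ, c†_i c_j φ⟩ = ⟨c_i φ, c_j φ⟩` (the one-particle density matrix as a Gram matrix).
[cite: BratteliRobinsonII1997, §5.2.2] -/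
theorem star_dotProduct_creation_mul_annihilation_mulVec (i j : ι) (φ : Fock ι) :
    star φ ⬝ᵥ ((creation i * annihilation j) *ᵥ φ) =
      star (annihilation i *ᵥ φ) ⬝ᵥ (annihilation j *ᵥ φ) := by
  rw [← Matrix.mulVec_mulVec, show creation i = (annihilation i)ᴴ from rfl, Matrix.dotProduct_mulVec,
    ← Matrix.star_mulVec]

omit [LinearOrder ι] in
/-- Gram symmetry `conj ⟨a, b⟩ = ⟨b, a⟩`. [folklore] -/
theorem star_star_dotProduct (a b : Fock ι) : star (star a ⬝ᵥ b) = star b ⬝ᵥ a := by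
  rw [Matrix.star_dotProduct, star_star]

omit [LinearOrder ι] in
/-- Cauchy–Schwarz: `|⟨a, b⟩|² ≤ ‖a‖² ‖b‖²`. [folklore] -/
theorem norm_star_dotProduct_sq_le_normSq_mul (a b : Fock ι) :
    ‖star a ⬝ᵥ b‖ ^ 2 ≤ normSq a * normSq b := by
  have h := norm_inner_le_norm (𝕜 := ℂ) (WithLp.toLp 2 a : EuclideanSpace ℂ (Finset ι))
    (WithLp.toLp 2 b)
  rw [EuclideanSpace.inner_toLp_toLp, dotProduct_comm] at h
  have hn : ∀ v : Fock ι, ‖(WithLp.toLp 2 v : EuclideanSpace ℂ (Finset ι))‖ ^ 2 = normSq v := by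
    intro v
    rw [EuclideanSpace.norm_sq_eq, normSq]
  calc ‖star a ⬝ᵥ b‖ ^ 2
      ≤ (‖(WithLp.toLp 2 a : EuclideanSpace ℂ (Finset ι))‖ *
          ‖(WithLp.toLp 2 b : EuclideanSpace ℂ (Finset ι))‖) ^ 2 :=
        pow_le_pow_left₀ (norm_nonneg _) h 2
    _ = normSq a * normSq b := by rw [mul_pow, hn, hn]

/-- **The Pauli principle for a smeared mode, general normalisation**: `‖c(f) ψ‖² ≤ ‖f‖² ‖ψ‖²`
(`c(f)c†(f) + c†(f)c(f) = ‖f‖²` and `c(f)c†(f) ≥ 0`). [cite: BratteliRobinsonII1997, §5.2.2, Prop. 5.2.2] -/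
theorem normSq_annihilate_mulVec_le_mul (f : ι → ℂ) (ψ : Fock ι) :
    normSq (annihilate f *ᵥ ψ) ≤ (star f ⬝ᵥ f).re * normSq ψ := by
  have h := annihilate_mul_create_add f f
  have key : ((normSq (create f *ᵥ ψ) : ℝ) : ℂ) + ((normSq (annihilate f *ᵥ ψ) : ℝ) : ℂ) =
      (star f ⬝ᵥ f) * ((normSq ψ : ℝ) : ℂ) := by
    rw [← star_dotProduct_annihilate_create_mulVec, ← star_dotProduct_numberMode_mulVec,
      numberMode, ← dotProduct_add, ← Matrix.add_mulVec, h, Matrix.smul_mulVec, Matrix.one_mulVec,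
      dotProduct_smul, star_dotProduct_self_eq_normSq, smul_eq_mul]
  have hre := congrArg Complex.re key
  rw [Complex.add_re, Complex.ofReal_re, Complex.ofReal_re, Complex.re_mul_ofReal] at hre
  linarith [normSq_nonneg (create f *ᵥ ψ)]

/-- **`γ² ≤ γ` row by row**: `Σ_j |⟨c_i φ, c_j φ⟩|² ≤ ‖φ‖² ‖c_i φ‖²` — the Gram (one-particle density)
matrix of any state has Frobenius row mass at most its diagonal (`0 ≤ γ ≤ 1`).
[cite: BachLiebSolovej1994, §2 eq. (2a.7)] -/
theorem sum_norm_sq_gram_le (φ : Fock ι) (i : ι) :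
    ∑ j, ‖star (annihilation i *ᵥ φ) ⬝ᵥ (annihilation j *ᵥ φ)‖ ^ 2 ≤
      normSq φ * normSq (annihilation i *ᵥ φ) := by
  obtain ⟨ψ, hψ⟩ : ∃ ψ, ψ = annihilation i *ᵥ φ := ⟨_, rfl⟩
  obtain ⟨α, hα⟩ : ∃ α : ι → ℂ, α = fun j => star ψ ⬝ᵥ (annihilation j *ᵥ φ) := ⟨_, rfl⟩
  obtain ⟨S, hS⟩ : ∃ S : ℝ, S = ∑ j, ‖α j‖ ^ 2 := ⟨_, rfl⟩
  rw [← hψ]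
  have hgoal : ∑ j, ‖star ψ ⬝ᵥ (annihilation j *ᵥ φ)‖ ^ 2 = S := by
    rw [hS, hα]
  rw [hgoal]
  have hS0 : 0 ≤ S := by rw [hS]; exact Finset.sum_nonneg fun j _ => by positivity
  -- `⟨ψ, c(α) φ⟩ = S`
  have h1 : star ψ ⬝ᵥ (annihilate α *ᵥ φ) = ((S : ℝ) : ℂ) := by
    have e : star ψ ⬝ᵥ (annihilate α *ᵥ φ) = ∑ j, star (α j) * α j := by
      simp only [annihilate, Matrix.sum_mulVec, Matrix.smul_mulVec, dotProduct_sum, dotProduct_smul,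
        smul_eq_mul, hα]
    rw [e, hS, Complex.ofReal_sum]
    refine Finset.sum_congr rfl fun j _ => ?_
    rw [Complex.star_def, Complex.conj_mul', Complex.ofReal_pow]
  -- `‖c(α) φ‖² ≤ S ‖φ‖²`
  have h2 : normSq (annihilate α *ᵥ φ) ≤ S * normSq φ := by
    have h := normSq_annihilate_mulVec_le_mul α φ
    have hre : (star α ⬝ᵥ α).re = S := by
      rw [dotProduct, Complex.re_sum, hS]
      refine Finset.sum_congr rfl fun j _ => ?_
      rw [Pi.star_apply, Complex.star_def, Complex.conj_mul', ← Complex.ofReal_pow, Complex.ofReal_re]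
    rwa [hre] at h
  -- Cauchy–Schwarz
  have h3 : S ^ 2 ≤ normSq ψ * (S * normSq φ) := by
    have hcs := norm_star_dotProduct_sq_le_normSq_mul ψ (annihilate α *ᵥ φ)
    rw [h1, Complex.norm_real, Real.norm_eq_abs, sq_abs] at hcs
    exact hcs.trans (mul_le_mul_of_nonneg_left h2 (normSq_nonneg ψ))
  by_cases hS' : S = 0
  · rw [hS']; exact mul_nonneg (normSq_nonneg φ) (normSq_nonneg ψ)
  · have hSpos : 0 < S := lt_of_le_of_ne hS0 (Ne.symm hS')
    nlinarith [h3, hSpos, normSq_nonneg φ, normSq_nonneg ψ]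

end Gram

/-! ### §2 Local moments versus the Frobenius mass of the one-particle density matrix -/

section Moments

variable {Λ : Type*} [LinearOrder Λ] [Fintype Λ]

omit [LinearOrder Λ] in
/-- `Σ_{o ∈ Λ×{↑,↓}} f(o) = Σ_x Σ_σ f(x,σ)`. [folklore] -/
theorem sum_orb_eq_sum_sum {M : Type*} [AddCommMonoid M] (f : Orb Λ → M) :
    ∑ o : Orb Λ, f o = ∑ x : Λ, ∑ σ : Fin 2, f (orb x σ) := by
  rw [← Fintype.sum_prod_type', ← (toLex : Λ × Fin 2 ≃ Orb Λ).sum_comp]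

/-- `Re⟨φ, n_{xσ} φ⟩ = ‖c_{xσ} φ‖²`. [folklore] -/
theorem re_expect_numberOp_eq_normSq (x : Λ) (σ : Fin 2) (φ : Fock (Orb Λ)) :
    (star φ ⬝ᵥ (numberOp x σ *ᵥ φ)).re = normSq (annihilation (orb x σ) *ᵥ φ) := by
  rw [show numberOp x σ = creation (orb x σ) * annihilation (orb x σ) from rfl,
    star_dotProduct_creation_mul_annihilation_mulVec, star_dotProduct_self_eq_normSq, Complex.ofReal_re]

/-- `Re⟨φ, N̂ φ⟩ = Σ_x Σ_σ ‖c_{xσ} φ‖²`. [folklore] -/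
theorem re_expect_totalNumber_eq_sum (φ : Fock (Orb Λ)) :
    (star φ ⬝ᵥ (totalNumber *ᵥ φ)).re = ∑ x : Λ, ∑ σ : Fin 2, normSq (annihilation (orb x σ) *ᵥ φ) := by
  rw [totalNumber, Matrix.sum_mulVec, dotProduct_sum, Complex.re_sum]
  refine Finset.sum_congr rfl fun x _ => ?_
  rw [Matrix.sum_mulVec, dotProduct_sum, Complex.re_sum]
  exact Finset.sum_congr rfl fun σ _ => re_expect_numberOp_eq_normSq x σ φ

/-- Parallelogram bookkeeping for four complex numbers:
`|a+d|² + |a-d|² + 2|b|² + 2|c|² = 2(|a|² + |b|² + |c|² + |d|²)`. [folklore] -/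
theorem norm_sq_four (a b c d : ℂ) :
    ‖a + d‖ ^ 2 + ‖a - d‖ ^ 2 + 2 * ‖b‖ ^ 2 + 2 * ‖c‖ ^ 2 =
      2 * (‖a‖ ^ 2 + ‖b‖ ^ 2 + ‖c‖ ^ 2 + ‖d‖ ^ 2) := by
  simp only [Complex.sq_norm, Complex.normSq_apply, Complex.add_re, Complex.add_im, Complex.sub_re,
    Complex.sub_im]
  ring

/-- **Local moments + Frobenius mass ≤ twice the particle number.** For every Fock vector `φ` on
`Λ × {↑,↓}`: `Σ_x [(Re⟨n_{x↑}-n_{x↓}⟩)² + 4|⟨c†_{x↑}c_{x↓}⟩|²] + Σ_{x,y} |Σ_σ ⟨c†_{xσ}c_{yσ}⟩|² ≤ 2‖φ‖² Re⟨N̂⟩`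
(for `‖φ‖ = 1`: `4Σ_x|⟨S_x⟩|² + ‖G‖_F² ≤ 2N`, `G` the spin-traced one-particle density matrix).
[cite: BachLiebSolovej1994, §2 eq. (2a.7)] -/
theorem four_localMoment_add_frob_le (φ : Fock (Orb Λ)) :
    (∑ x : Λ, (((star φ ⬝ᵥ ((numberOp x 0 - numberOp x 1) *ᵥ φ)).re) ^ 2 +
        4 * ‖star φ ⬝ᵥ ((creation (orb x 0) * annihilation (orb x 1)) *ᵥ φ)‖ ^ 2)) +
      ∑ x : Λ, ∑ y : Λ, ‖∑ σ : Fin 2, star φ ⬝ᵥ ((creation (orb x σ) * annihilation (orb y σ)) *ᵥ φ)‖ ^ 2 ≤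
      2 * normSq φ * (star φ ⬝ᵥ (totalNumber *ᵥ φ)).re := by
  -- the Gram matrix `g i j = ⟨c_i φ, c_j φ⟩`
  obtain ⟨a, ha⟩ : ∃ a : Orb Λ → Fock (Orb Λ), a = fun i => annihilation i *ᵥ φ := ⟨_, rfl⟩
  obtain ⟨g, hg⟩ : ∃ g : Orb Λ → Orb Λ → ℂ, g = fun i j => star (a i) ⬝ᵥ (a j) := ⟨_, rfl⟩
  have hexp : ∀ (x y : Λ) (σ τ : Fin 2),
      star φ ⬝ᵥ ((creation (orb x σ) * annihilation (orb y τ)) *ᵥ φ) = g (orb x σ) (orb y τ) := by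
    intro x y σ τ; rw [hg, ha, star_dotProduct_creation_mul_annihilation_mulVec]
  have hdiag : ∀ i, g i i = ((normSq (a i) : ℝ) : ℂ) := by
    intro i; rw [hg]; exact star_dotProduct_self_eq_normSq (a i)
  have hstar : ∀ i j, g j i = star (g i j) := by
    intro i j; rw [hg, star_star_dotProduct]
  have hnorm : ∀ i j, ‖g j i‖ = ‖g i j‖ := by
    intro i j; rw [hstar i j, norm_star]
  -- the number operators
  have hnum : ∀ x : Λ, (star φ ⬝ᵥ ((numberOp x 0 - numberOp x 1) *ᵥ φ)).re =
      normSq (a (orb x 0)) - normSq (a (orb x 1)) := by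
    intro x
    rw [Matrix.sub_mulVec, dotProduct_sub, Complex.sub_re, re_expect_numberOp_eq_normSq,
      re_expect_numberOp_eq_normSq, ha]
  have hN : (star φ ⬝ᵥ (totalNumber *ᵥ φ)).re = ∑ i : Orb Λ, normSq (a i) := by
    rw [re_expect_totalNumber_eq_sum, sum_orb_eq_sum_sum, ha]
  -- (1) the total Frobenius mass
  have hT : ∑ i : Orb Λ, ∑ j : Orb Λ, ‖g i j‖ ^ 2 ≤ normSq φ * ∑ i : Orb Λ, normSq (a i) := by
    rw [Finset.mul_sum]
    refine Finset.sum_le_sum fun i _ => ?_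
    have h := sum_norm_sq_gram_le φ i
    rw [hg, ha]
    exact h
  -- (2) the pair identity, summed
  have hpair : ∀ x y : Λ,
      ‖g (orb x 0) (orb y 0) + g (orb x 1) (orb y 1)‖ ^ 2 +
          ‖g (orb x 0) (orb y 0) - g (orb x 1) (orb y 1)‖ ^ 2 +
          2 * ‖g (orb x 0) (orb y 1)‖ ^ 2 + 2 * ‖g (orb x 1) (orb y 0)‖ ^ 2 =
        2 * ∑ σ : Fin 2, ∑ τ : Fin 2, ‖g (orb x σ) (orb y τ)‖ ^ 2 := by
    intro x y
    rw [norm_sq_four, Fin.sum_univ_two, Fin.sum_univ_two, Fin.sum_univ_two]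
    ring
  have hreindex : ∑ x : Λ, ∑ y : Λ, ∑ σ : Fin 2, ∑ τ : Fin 2, ‖g (orb x σ) (orb y τ)‖ ^ 2 =
      ∑ i : Orb Λ, ∑ j : Orb Λ, ‖g i j‖ ^ 2 := by
    rw [sum_orb_eq_sum_sum]
    refine Finset.sum_congr rfl fun x _ => ?_
    rw [Finset.sum_comm]
    refine Finset.sum_congr rfl fun σ _ => ?_
    rw [sum_orb_eq_sum_sum]
  -- (3) diagonal terms
  have hdiagx : ∀ x : Λ,
      ((star φ ⬝ᵥ ((numberOp x 0 - numberOp x 1) *ᵥ φ)).re) ^ 2 +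
          4 * ‖star φ ⬝ᵥ ((creation (orb x 0) * annihilation (orb x 1)) *ᵥ φ)‖ ^ 2 =
        ‖g (orb x 0) (orb x 0) - g (orb x 1) (orb x 1)‖ ^ 2 +
          2 * ‖g (orb x 0) (orb x 1)‖ ^ 2 + 2 * ‖g (orb x 1) (orb x 0)‖ ^ 2 := by
    intro x
    rw [hnum, hexp, hdiag, hdiag, ← Complex.ofReal_sub, Complex.norm_real, Real.norm_eq_abs, sq_abs,
      hnorm (orb x 0) (orb x 1)]
    ring
  -- the off-diagonal part of the pair sum is nonnegative: diagonal ≤ full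
  have hdrop : ∑ x : Λ, (‖g (orb x 0) (orb x 0) - g (orb x 1) (orb x 1)‖ ^ 2 +
        2 * ‖g (orb x 0) (orb x 1)‖ ^ 2 + 2 * ‖g (orb x 1) (orb x 0)‖ ^ 2) ≤
      ∑ x : Λ, ∑ y : Λ, (‖g (orb x 0) (orb y 0) - g (orb x 1) (orb y 1)‖ ^ 2 +
        2 * ‖g (orb x 0) (orb y 1)‖ ^ 2 + 2 * ‖g (orb x 1) (orb y 0)‖ ^ 2) := by
    refine Finset.sum_le_sum fun x _ => ?_
    exact Finset.single_le_sum (f := fun y => ‖g (orb x 0) (orb y 0) - g (orb x 1) (orb y 1)‖ ^ 2 +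
        2 * ‖g (orb x 0) (orb y 1)‖ ^ 2 + 2 * ‖g (orb x 1) (orb y 0)‖ ^ 2)
      (fun y _ => by positivity) (Finset.mem_univ x)
  -- assemble
  have hG : ∀ x y : Λ, ∑ σ : Fin 2, star φ ⬝ᵥ ((creation (orb x σ) * annihilation (orb y σ)) *ᵥ φ) =
      g (orb x 0) (orb y 0) + g (orb x 1) (orb y 1) := by
    intro x y; rw [Fin.sum_univ_two, hexp, hexp]
  simp_rw [hdiagx, hG]
  have hsplit : ∑ x : Λ, ∑ y : Λ, (‖g (orb x 0) (orb y 0) + g (orb x 1) (orb y 1)‖ ^ 2 +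
      (‖g (orb x 0) (orb y 0) - g (orb x 1) (orb y 1)‖ ^ 2 +
        2 * ‖g (orb x 0) (orb y 1)‖ ^ 2 + 2 * ‖g (orb x 1) (orb y 0)‖ ^ 2)) =
      2 * ∑ i : Orb Λ, ∑ j : Orb Λ, ‖g i j‖ ^ 2 := by
    rw [← hreindex, Finset.mul_sum]
    refine Finset.sum_congr rfl fun x _ => ?_
    rw [Finset.mul_sum]
    refine Finset.sum_congr rfl fun y _ => ?_
    rw [← hpair x y]
    ring
  have hsum2 : ∑ x : Λ, ∑ y : Λ, ‖g (orb x 0) (orb y 0) + g (orb x 1) (orb y 1)‖ ^ 2 +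
      ∑ x : Λ, ∑ y : Λ, (‖g (orb x 0) (orb y 0) - g (orb x 1) (orb y 1)‖ ^ 2 +
        2 * ‖g (orb x 0) (orb y 1)‖ ^ 2 + 2 * ‖g (orb x 1) (orb y 0)‖ ^ 2) =
      2 * ∑ i : Orb Λ, ∑ j : Orb Λ, ‖g i j‖ ^ 2 := by
    rw [← hsplit, ← Finset.sum_add_distrib]
    refine Finset.sum_congr rfl fun x _ => ?_
    rw [← Finset.sum_add_distrib]
  rw [hN]
  linarith [hdrop, hsum2, hT]

end Moments

end GHFClassFloor

end Summit.Ventures.CertifiedManyBodySolver.Observables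

end
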